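import Literature.AlgebraicGeometry.Resolution.LocalBlowup
import Mathlib.Algebra.Ring.Aut
import HarnessLib

/-!
# The local ring of the invariants is the ring of invariants of the local ring (tame cyclic descent, model bookkeeping)

Topic: `Literature/AlgebraicGeometry/Resolution`. PROOF side of `CossartPiltant2019ReductionP`
(`ArithmeticalThreefoldsLocal.lean`), fourth brick (after `TameCyclicInvariants.lean`,
`TameCyclicEigenparameters.lean`, `TameCyclicFixedRing.lean`) of its one remaining input (C4) —
descent of local uniformization below the ramification field ([CoP1] Props. 9.3/9.5 with
Lemma 9.4). In the proof of [CoP1] Lemma 9.4 (HAL p. 29) the local uniformization downstairs is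
the ring of invariants of a `G`-stable local model upstairs: "`S̄ := S[y₁, y₂, y₃]` … `S₁ := S̄_{𝔪_W ∩ S̄}`
is a local model of `W` … Let `R₁ := S₁^G`. Then `R₁` is a normal local model of `V/k` and `S₁`
lies above `R₁`". That `R₁` is again a LOCAL MODEL — the local ring, at the centre of the
valuation, of the ring of invariants `S̄^G` of the finitely generated model — rests on the
commutation of invariants with localisation at the centre of a `G`-stable valuation ring, which
this file proves in the tree's currency (`locAtCentre`, `LocalBlowup.lean`), for a cyclic group:

* `locAtCentre_inf_fixedSubring_eq` — PROVED: for a field automorphism `σ` of finite order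
  preserving a valuation ring `O` and a subring `T` of `K`, and `F` the fixed field/subring of `σ`,
  `(T_{𝔪_O ∩ T}) ∩ F = (T ∩ F)_{𝔪_O ∩ (T ∩ F)}` inside `K`: an invariant fraction `y/z` (`y, z ∈ T`,
  `v(z) = 0`) is `y′/z′` with `z′ = ∏ᵢ σⁱ z` the norm of the denominator and `y′ = (y/z) z′`, both
  invariant and in `T`.

Everything is PROVED; no named facts are introduced.

## Sources

* V. Cossart, O. Piltant, *Resolution of singularities of threefolds in positive characteristic.
  I*, J. Algebra 320 (2008) 1051–1082: proof of Lemma 9.4 (HAL hal-00139124, p. 29).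
  [CossartPiltant2008]
-/

noncomputable section

namespace Literature.AlgebraicGeometry.Resolution

universe u

section FixedModel

variable {K : Type u} [Field K] (σ : K ≃+* K)

/-- Powers of `σ` preserve a `σ`-stable subset. [folklore] -/
private theorem pow_apply_mem_of_stable {S : Set K} (hS : ∀ x ∈ S, σ x ∈ S) (i : ℕ) {x : K}
    (hx : x ∈ S) : (σ ^ i) x ∈ S := by
  induction i with
  | zero => simpa using hx
  | succ i ih => rw [pow_succ', RingAut.mul_apply]; exact hS _ ih

/-- `σ` fixes the norm `∏_{i<ℓ} σⁱ z` when `σ^ℓ = 1`. [folklore] -/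
private theorem apply_prod_pow_apply {ℓ : ℕ} (hℓ0 : ℓ ≠ 0) (hσℓ : σ ^ ℓ = 1) (z : K) :
    σ (∏ i ∈ Finset.range ℓ, (σ ^ i) z) = ∏ i ∈ Finset.range ℓ, (σ ^ i) z := by
  rw [map_prod]
  let f : ℕ → K := fun i => (σ ^ i) z
  have hf : ∀ i, σ ((σ ^ i) z) = f (i + 1) := fun i => by
    change σ ((σ ^ i) z) = (σ ^ (i + 1)) z
    rw [pow_succ', RingAut.mul_apply]
  simp only [hf]
  have hfℓ : f ℓ = f 0 := by
    change (σ ^ ℓ) z = (σ ^ 0) z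
    rw [hσℓ, pow_zero]
  obtain ⟨m, hm⟩ : ∃ m, ℓ = m + 1 := ⟨ℓ - 1, by omega⟩
  rw [hm, Finset.prod_range_succ' f, Finset.prod_range_succ (fun x => f (x + 1)), ← hm, hfℓ]

/-- An automorphism preserving a valuation ring preserves the elements of value `0`
(multiplicatively: `O.valuation z = 1`). [folklore] -/
private theorem valuation_apply_eq_one (O : ValuationSubring K) (hO : ∀ x ∈ O, σ x ∈ O) {z : K}
    (hz : O.valuation z = 1) : O.valuation (σ z) = 1 := by
  have hz0 : z ≠ 0 := ne_zero_of_valuation_eq_one hz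
  have hzO : z ∈ O := (O.valuation_le_one_iff z).mp hz.le
  have hziO : z⁻¹ ∈ O := (O.valuation_le_one_iff _).mp (by rw [map_inv₀, hz, inv_one])
  have h1 : O.valuation (σ z) ≤ 1 := (O.valuation_le_one_iff _).mpr (hO z hzO)
  have h2 : O.valuation (σ z)⁻¹ ≤ 1 := by
    rw [← map_inv₀ σ]
    exact (O.valuation_le_one_iff _).mpr (hO _ hziO)
  rw [map_inv₀] at h2
  have hσz0 : O.valuation (σ z) ≠ 0 := by
    rw [ne_eq, map_eq_zero]
    exact (map_ne_zero σ).mpr hz0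
  exact le_antisymm h1 ((inv_le_one₀ (zero_lt_iff.mpr hσz0)).mp h2)

/-- **The ring of invariants of the local model is the local ring of the invariants** ([CoP1]
proof of Lemma 9.4: "`S₁ := S̄_{𝔪_W ∩ S̄}` is a local model of `W` … Let `R₁ := S₁^G`. Then `R₁`
is a normal local model of `V/k` and `S₁` lies above `R₁`", HAL p. 29 — the invariants of the
localisation at the centre of the `G`-stable valuation `W` are the localisation of the invariants
of the finitely generated model `S̄`). For a field automorphism `σ` with `σ^ℓ = 1` (`ℓ ≠ 0`)
preserving a valuation ring `O` and a subring `T` of `K`, and `F` the fixed subring of `σ`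
(`x ∈ F ↔ σ x = x`): `T_{𝔪_O ∩ T} ∩ F = (T ∩ F)_{𝔪_O ∩ (T ∩ F)}` (`locAtCentre`). Proof: an
invariant `y/z` (`y, z ∈ T`, `v(z) = 0`) equals `y′/z′` with `z′ := ∏_{i<ℓ} σⁱ z ∈ T ∩ F` of value
`0` and `y′ := (y/z)·z′ = y ∏_{0<i<ℓ} σⁱ z ∈ T ∩ F`.
[cite: CossartPiltant2008, proof of Lemma 9.4 (HAL p. 29), "`R₁ := S₁^G` … is a normal local model"] -/
theorem locAtCentre_inf_fixedSubring_eq {ℓ : ℕ} (hℓ0 : ℓ ≠ 0) (hσℓ : σ ^ ℓ = 1)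
    (O : ValuationSubring K) (hO : ∀ x ∈ O, σ x ∈ O)
    (T : Subring K) (hT : ∀ x ∈ T, σ x ∈ T)
    (F : Subring K) (hF : ∀ x : K, x ∈ F ↔ σ x = x) :
    locAtCentre T O ⊓ F = locAtCentre (T ⊓ F) O := by
  classical
  apply le_antisymm
  · rintro x ⟨hxT, hxF⟩
    have hσx : σ x = x := (hF x).mp hxF
    obtain ⟨y, hy, z, hz, hvz, rfl⟩ := mem_locAtCentre_iff.mp hxT
    have hz0 : z ≠ 0 := ne_zero_of_valuation_eq_one hvz
    -- the norm of the denominator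
    set z' : K := ∏ i ∈ Finset.range ℓ, (σ ^ i) z with hz'def
    have hz'T : z' ∈ T := Subring.prod_mem _ fun i _ => pow_apply_mem_of_stable σ hT i hz
    have hσz' : σ z' = z' := apply_prod_pow_apply σ hℓ0 hσℓ z
    have hvz' : O.valuation z' = 1 := by
      rw [hz'def, map_prod]
      have hvi : ∀ i : ℕ, O.valuation ((σ ^ i) z) = 1 := fun i => by
        induction i with
        | zero => simpa using hvz
        | succ i ih => rw [pow_succ', RingAut.mul_apply]; exact valuation_apply_eq_one σ O hO ih
      exact Finset.prod_eq_one fun i _ => hvi i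
    have hz'0 : z' ≠ 0 := ne_zero_of_valuation_eq_one hvz'
    -- `z' = (∏_{0<i<ℓ} σⁱ z) * z`
    obtain ⟨m, hm⟩ : ∃ m, ℓ = m + 1 := ⟨ℓ - 1, by omega⟩
    set z'' : K := ∏ i ∈ Finset.range m, (σ ^ (i + 1)) z with hz''def
    have hz'eq : z' = z'' * z := by
      rw [hz'def, hm, Finset.prod_range_succ' (fun i => (σ ^ i) z)]
      simp [hz''def]
    have hz''T : z'' ∈ T :=
      Subring.prod_mem _ fun i _ => pow_apply_mem_of_stable σ hT (i + 1) hz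
    -- the new numerator
    set y' : K := y / z * z' with hy'def
    have hy'eq : y' = y * z'' := by
      rw [hy'def, hz'eq]; field_simp
    have hy'T : y' ∈ T := by rw [hy'eq]; exact T.mul_mem hy hz''T
    have hσy' : σ y' = y' := by rw [hy'def, map_mul, hσx, hσz']
    refine mem_locAtCentre_iff.mpr ⟨y', ⟨hy'T, (hF _).mpr hσy'⟩, z', ⟨hz'T, (hF _).mpr hσz'⟩,
      hvz', ?_⟩
    rw [hy'def, mul_div_assoc, div_self hz'0, mul_one]
  · intro x hx
    refine ⟨locAtCentre_mono O inf_le_left hx, ?_⟩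
    obtain ⟨y, ⟨-, hyF⟩, z, ⟨-, hzF⟩, -, rfl⟩ := mem_locAtCentre_iff.mp hx
    exact (hF _).mpr (by rw [map_div₀, (hF y).mp hyF, (hF z).mp hzF])

end FixedModel

end Literature.AlgebraicGeometry.Resolution

end
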